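/-
Origin: expansion seat `planner-pub-hodgecm-pv09-0`, handover 2026-08-18T03:35:39Z (`HOME/pub-hodgecm-pv09/lean/Pv09/RallisIP.lean`, md5 ce3ea737, 130 lines);
landed by the gen-5 packager in gate run 19 as `HodgeCM/PerL34/RallisIP.lean` (import ^import Pv[0-9]+\.→import HodgeCM.PerL34. ×2).
-/
/-
pub-hodgecm speedrun cell, prover pv09 — WIP module `Pv09.RallisIP` (landing target `HodgeCM/PerL34/RallisIP.lean`
= the carver's planned stub name for node N31e).  Imports: Mathlib (via the two sibling files).  Nothing posited
beyond DATA; every hypothesis is an earlier DAG node (labelled) — cell ABSOLUTE RULE respected.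

# Node N31e (LEMMAS.md §1; PerL v5, proof of Lemma 4.2(b) `lem:chars`(b), tex ll. 588–608):
  ORBITS & UNFOLDING ⇒ Rallis' inner product formula in Weil's convergent range, with PerL's orientation

  ⟨θ_φ(χ'), θ_φ(χ')⟩ = c · vol([U(W_i)]) · ∫_{U(W_i)(𝔸)} ⟨ω(y)φ, φ⟩ χ'(y) dy        (tex l. 600)

VERBATIM CHECK (step (i) of the prover protocol): the carver's typed layer (`Carver/PerL34/Chars.lean`,
03:27Z) does not type N31e separately — it maps N31e to the FIELD `RallisDatum.AX7_factor` of the prior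
programme's Euler-product skeleton, which is the FACTORED form `⟨θ,θ⟩ = c·∏_v I_v` = N31e (this file, global
integral) + the first sentence of N31f ("for φ = ⊗φ_v … this integral is the product of the local factors", l. 608).
So N31e is typed here by pv09 directly from tex ll. 588–608, over the shared doubling vocabulary agreed in
HOME/STATUS.md 03:25Z–03:28Z (pv05 N31b `DoublingDatum` field shapes: `ι : A × A →* H`, `ω : A →* (S ≃ₗᵢ[ℂ] S)`,
`χV : A →* ℂ` unitary, PerL bracket ⟨a,b⟩ = `inner ℂ b a`; pv11 N31c output shape (eq:basic)).

HONEST SPLIT (L2):   N31c ∧ N31d ∧ N31f-integrability  →  N31e,   with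
  X₁ = (eq:basic)                                   — hypothesis `hbasic`  (node N31c, pv11; its output verbatim)
  X₂ = f_Φ(·,s₀) left P(L₀)-invariant (l. 572),
       E(·,s₀;f_Φ) = Σ_{P(L₀)\H(L₀)} f_Φ(γ ·,s₀) converges at ι(u,u') (l. 573–574),
       kernel identity ∫_{[G_U]} θ_φ(g,u) θ̄_φ(g,u') dg = c χ_V(u')⁻¹ E(ι(u,u'),s₀;f_Φ) (l. 580–581)
                                                     — hypotheses `hPinv`, `hEis`, `hK`  (node N31d, pv15)
  X₃ = ∫_{U(W_i)(𝔸)} |⟨ω(y)φ,φ⟩| dy < ∞ (l. 594 "licensed by the absolute convergence … established place by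
       place in the next paragraph")                 — hypothesis `hint`  (node N31f, pv07)
  KERNEL-PROVED here (files `Pv09.DoublingOrbit`, `Pv09.RallisUnfold`): the orbit lemma (l. 588–590), the
  re-indexing E(ι(u,u')) = Σ_{δ'} f_Φ(ι(u,δ'⁻¹u')) (l. 590), rational cancellation χ_V(δ') = 1 ⇒ "no twist
  survives" (l. 591–593), the unfolding against ∫_{[U(W_i)]} du' (l. 594–598), the substitution and the two
  unitarity identities (l. 599–602), and the ORIENTATION χ'(y) (not χ̄'(y)) forced by (eq:basic) (l. 605–608;
  review R3 first error / R2 E1').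
MODEL of [U(W_i)] = U(W_i)(L₀)\U(W_i)(𝔸): a fundamental domain `𝓕 ⊂ A` for the rational points `Γ = jA(unitary L)`
acting by left multiplication; ∫_{[U(W_i)]} := ∫_𝓕 dμ (μ = Haar measure of A), vol([U(W_i)]) = μ(𝓕).
-/
import Summits.HodgeConjecture.HodgeCM.PerL34.RallisUnfold
import Summits.HodgeConjecture.HodgeCM.PerL34.DoublingOrbit

/-! PORT of `HodgeCM/PerL34/RallisIP.lean` (HodgeCMPerL run 81) — verbatim mechanical port; provenance in the PORT header line. -/

set_option autoImplicit false

open MeasureTheory Complex ComplexConjugate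

namespace HodgeCM.PerL34.RallisIP

section node

variable {L : Type*} [Field L] [StarRing L] {W : Type*} [AddCommGroup W] [Module L W]
variable {A H S : Type*} [CommGroup A] [Group H] [NormedAddCommGroup S] [InnerProductSpace ℂ S]
  [MeasurableSpace A]

/-- The Eisenstein summand `P(L₀)γ ↦ f_Φ(γ·x, s₀)` on `P(L₀)\H(L₀)` (tex l. 573–574), well defined because
`f_Φ(·,s₀)` is left `P(L₀)`-invariant (tex l. 572, node N31d). `j : H(L₀) → H(𝔸)` is the inclusion of rational
points. -/
def eisTerm (h : W →ₗ⋆[L] W →ₗ[L] L) (j : isomBox h →* H) (fbox : H → ℂ)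
    (hPinv : ∀ p ∈ (stabDelta L W).subgroupOf (isomBox h), ∀ x : H, fbox (j p * x) = fbox x) (x : H) :
    Quotient (QuotientGroup.rightRel ((stabDelta L W).subgroupOf (isomBox h))) → ℂ :=
  cosetLift ((stabDelta L W).subgroupOf (isomBox h)) (fun γ => fbox (j γ * x))
    (by intro p hp γ; simp only [map_mul, mul_assoc]; exact hPinv p hp _)

/-- **N31e, conclusion** (tex l. 597–600), over a fundamental domain `𝓕` for `[U(W_i)]`:
`∫∫_{[U(W_i)]²} χ'(u) χ̄'(u') (∫_{[G_U]} θ_φ(g,u) θ̄_φ(g,u') dg) du' du = c·vol([U(W_i)])·∫_{U(W_i)(𝔸)} ⟨ω(y)φ,φ⟩ χ'(y) dy`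
(PerL bracket ⟨ω(y)φ,φ⟩ = `inner ℂ φ (ω y φ)`). -/
def N31e_statement (μ : Measure A) (𝓕 : Set A) (ω : A →* (S ≃ₗᵢ[ℂ] S)) (φ : S) (χ' : A → ℂ)
    (K : A → A → ℂ) (c : ℂ) : Prop :=
  ∫ u in 𝓕, ∫ u' in 𝓕, χ' u * conj (χ' u') * K u u' ∂μ ∂μ
    = c * (μ 𝓕).toReal * ∫ y, inner ℂ φ (ω y φ) * χ' y ∂μ

/-- **N31e** (PerL v5, Lemma 4.2(b) proof, tex ll. 588–608) as an HONEST SPLIT from N31c, N31d, N31f. -/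
theorem N31e_holds
    -- the hermitian line W_i over the CM field L (star = complex conjugation): rational side of the orbit lemma
    {h : W →ₗ⋆[L] W →ₗ[L] L} (hW : IsLine L W) (hh : Anisotropic h)
    -- adelic side: Haar measure on A = U(W_i)(𝔸) (abelian ⇒ inversion invariant)
    [MeasurableMul₂ A] [MeasurableInv A] (μ : Measure A) [μ.IsMulLeftInvariant] [μ.IsInvInvariant]
    (ι : A × A →* H) (ω : A →* (S ≃ₗᵢ[ℂ] S)) (χV : A →* ℂ) (norm_χV : ∀ a, ‖χV a‖ = 1)
    -- rational points inside adelic points: U(W_i)(L₀) = unitary L ↪ A, H(L₀) = isomBox h → H(𝔸), compatibly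
    [Countable (unitary L)] (jA : unitary L →* A) (hjA : Function.Injective jA)
    (j : isomBox h →* H) (hj : ∀ d : unitary L, j ⟨iotaSnd d, iotaSnd_mem h d⟩ = ι (1, jA d))
    {𝓕 : Set A} (h𝓕 : IsFundamentalDomain jA.range 𝓕 μ)
    -- Hecke characters restricted to U(W_i)(𝔸): χ' unitary, measurable, trivial on rational points;
    -- χ_V trivial on rational points ("χ_V(δ') = 1 for the principal idele δ'", l. 592)
    (χ' : A → ℂ) (hχ' : IsAutChar jA.range χ') (hχ'm : Measurable χ')
    (hχVΓ : ∀ d : unitary L, χV (jA d) = 1)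
    (φ : S) (fbox E : H → ℂ) (K : A → A → ℂ) (c : ℂ)
    -- (N31c) the two-variable basic identity (eq:basic), tex l. 566
    (hbasic : ∀ h₁ h₂ : A, fbox (ι (h₁, h₂)) = χV h₂ * inner ℂ (ω h₂ φ) (ω h₁ φ))
    -- (N31d) tex l. 572, 573–574, 580–581
    (hPinv : ∀ p ∈ (stabDelta L W).subgroupOf (isomBox h), ∀ x : H, fbox (j p * x) = fbox x)
    (hEis : ∀ u u' : A, HasSum (eisTerm h j fbox hPinv (ι (u, u'))) (E (ι (u, u'))))
    (hK : ∀ u u' : A, K u u' = c * (χV u')⁻¹ * E (ι (u, u')))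
    -- (N31f) absolute integrability of the matrix coefficient on U(W_i)(𝔸), tex l. 594
    (hint : Integrable (fun y => inner ℂ φ (ω y φ)) μ) :
    N31e_statement μ 𝓕 ω φ χ' K c := by
  classical
  -- the rational points as a subgroup Γ of A, countable
  set Γ : Subgroup A := jA.range with hΓ
  let eΓ : unitary L ≃ Γ := (MonoidHom.ofInjective hjA).toEquiv
  haveI : Countable Γ := Countable.of_equiv _ eΓ
  -- ω as a unitary action, χ_V and χ' as automorphic characters
  have hω : IsUnitaryAction (fun a (v : S) => ω a v) :=
    { map_one := fun v => by simp
      map_mul := fun g g' v => by simp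
      inner_map := fun g v w => LinearIsometryEquiv.inner_map_map (ω g) v w }
  have hχV : IsAutChar Γ (fun a => χV a) :=
    { map_mul := fun g g' => map_mul χV g g'
      norm_eq := norm_χV
      triv := by
        rintro ⟨_, d, rfl⟩
        exact hχVΓ d }
  -- STEP 1 (orbit lemma, tex l. 588–590): E(ι(u,u')) = Σ_{δ' ∈ U(W_i)(L₀)} f_Φ(ι(u, δ'⁻¹ u'))
  have hE : ∀ u u' : A, HasSum (fun γ : Γ => fbox (ι (u, γ⁻¹ • u'))) (E (ι (u, u'))) := by
    intro u u'
    have h1 := (eisenstein_reindex hW hh (fun γ => fbox (j γ * ι (u, u')))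
      (by intro p hp γ; simp only [map_mul, mul_assoc]; exact hPinv p hp _) (E (ι (u, u')))).mp (hEis u u')
    -- rewrite the summand: j(ι(1,δ')⁻¹)·ι(u,u') = ι(u, δ'⁻¹u')
    have h2 : (fun d : unitary L => fbox (j (⟨iotaSnd d, iotaSnd_mem h d⟩ : isomBox h)⁻¹ * ι (u, u')))
        = fun d : unitary L => fbox (ι (u, (jA d)⁻¹ * u')) := by
      funext d
      rw [map_inv, hj, ← map_inv, ← map_mul, Prod.inv_mk, inv_one, Prod.mk_mul_mk, one_mul]
    rw [h2] at h1
    -- transport along unitary L ≃ Γ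
    refine (eΓ.hasSum_iff (f := fun γ : Γ => fbox (ι (u, γ⁻¹ • u')))).mp ?_
    convert h1 using 2 with d
    simp [eΓ, Subgroup.smul_def, MonoidHom.ofInjective_apply]
  -- STEP 2 (tex l. 591–602): rational cancellation, unfolding, substitution — `rallis_inner_product_formula`
  exact rallis_inner_product_formula (Γ := Γ) (ω := fun a (v : S) => ω a v) (φ := φ) (χ' := χ') (χV := fun a => χV a)
    (f := fun u v => fbox (ι (u, v))) (E := fun u u' => E (ι (u, u'))) (K := K) (c := c)
    h𝓕 hω hχ' hχ'm hχV hbasic hE hK hint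

end node

end HodgeCM.PerL34.RallisIP
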